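import Mathlib
import Summits.Ventures.DiscreteObjects.Mahler.CongruentOneCoefficients

/-!
# Sparse reciprocal polynomials I: `M ≥ √2` for cyclotomic-free (anti)reciprocal quadrinomials
(venture `DiscreteObjects`, target L)

Cell `pub-namedobj`, seat `pub-namedobj-mahler-g24`. Framing: lottery ticket; floor = certified
bounds/negative ranges.

A (anti)reciprocal integer polynomial with nonzero constant term and at most four monomials is, up to
sign, `a(xⁿ ± 1)`, `x^{2m} + c x^m + 1`, or `x^{p+q} + b x^p + s b x^q + s` (`0 < p < q`, `s = ±1`).
For the last shape we prove, by the resultant method of Borwein–Dobrowolski–Mossinghoff (the abstract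
Lemma 3.1 of [BDM07] is `pow_le_abs_resultant_of_eq` in `CongruentOneCoefficients`) with the auxiliary
polynomials `X^n + s` and `X^{2n} - 1`:

* `abs_pow_le_pow_mul_measure_pow_of_resultant` — the general step: if `G = m·T + f·P`,
  `Res(f, G) ≠ 0` and `|G(α)| ≤ K max(1,|α|)^N` on `ℂ`, then `|m|^{deg f} ≤ K^{deg f} M(f)^N`;
* `abs_le_two_mul_measure_quadrinomial` — `|b| ≤ 2 M(P)` for cyclotomic-free
  `P = x^{p+q} + b x^p + s b x^q + s` (congruence `P ≡ xⁿ + s (mod b)`, auxiliary `xⁿ + s`);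
* `abs_le_measure_sq_quadrinomial` — `|b| ≤ M(P)²` when moreover `b` is even (at a root `α`:
  `αⁿ + s = -bT(α)` AND `αⁿ - s = -bT(α) - 2s` with `T = x^p + s x^q`, so the auxiliary `x^{2n} - 1`
  is `≡ 0 (mod 2b)` along `P`);
* `not_cyclotomicFree_quadrinomial_of_abs_le_one` — `|b| ≤ 1` forces a root of unity among the roots
  (`b = ±1`: `P = (x^p + e)(x^q + s e)`, `e = s b`);
* `sqrt_two_le_measure_quadrinomial` — hence **`M(P) ≥ √2`** for every cyclotomic-free `P` of this
  shape (`b` even: `M² ≥ |b| ≥ 2`; `b` odd: `M ≥ |b|/2 ≥ 3/2`).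

The trinomial shape is treated the same way in `ReciprocalTrinomialMeasureBound`.  Print:
Dobrowolski–Smyth, Int. J. Number Theory 13 (2017) (arXiv:1606.04376), Thm 1, give `M(f) ≥ h(f)/2^{k-2}`
for integer `k`-nomials of height `h(f)`, i.e. `h/4` for quadrinomials; the bounds above are `√h` resp.
`h/2` for this reciprocal shape and put every cyclotomic-free one above `√2` (with Smyth's theorem for the
nonreciprocal shapes: every cyclotomic-free integer polynomial with at most four monomials has
`M ≥ θ₀ = 1.3247…` — assembled in a sequel file).  Ours as far as searched; PROVISIONAL.
-/

namespace Summit.Ventures.DiscreteObjects.Mahler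

open Polynomial

/-! ### The resultant step, general form -/

/-- **The BDM resultant step with a general auxiliary polynomial.**  If `G = m T + f P` in `ℤ[X]` with
`deg P + deg f ≤ N`, `deg G ≤ N`, `Res_{(deg f, N)}(f, G) ≠ 0`, and `|G(α)| ≤ K · max(1,|α|)^N` for all
complex `α`, then `|m|^{deg f} ≤ K^{deg f} · M(f)^N`. -/
theorem abs_pow_le_pow_mul_measure_pow_of_resultant {f G T P : ℤ[X]} {m : ℤ} {N : ℕ} {K : ℝ}
    (hG : G = C m * T + f * P) (hP : P.natDegree + f.natDegree ≤ N)
    (hGN : G.natDegree ≤ N) (hne : f.resultant G f.natDegree N ≠ 0)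
    (hroot : ∀ α : ℂ, ‖(G.map (Int.castRingHom ℂ)).eval α‖ ≤ K * max 1 ‖α‖ ^ N) :
    (|m| : ℝ) ^ f.natDegree ≤ K ^ f.natDegree * intMahlerMeasure f ^ N := by
  have hlow := pow_le_abs_resultant_of_eq hG hP hne
  have hinj : Function.Injective (Int.castRingHom ℂ) := (Int.castRingHom ℂ).injective_int
  have hlowR : (|m| : ℝ) ^ f.natDegree ≤ ‖((f.resultant G f.natDegree N : ℤ) : ℂ)‖ := by
    rw [Complex.norm_intCast]
    exact_mod_cast hlow
  rw [resultant_intCast_eq (f := f) (N := N) hGN, norm_mul, norm_pow] at hlowR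
  have hmp := map_multiset_prod (normHom : ℂ →*₀ ℝ)
    (((f.map (Int.castRingHom ℂ)).roots.map (G.map (Int.castRingHom ℂ)).eval))
  rw [Multiset.map_map] at hmp
  simp only [normHom_apply, Function.comp_def] at hmp
  rw [hmp] at hlowR
  set d := f.natDegree with hd
  have hcard : Multiset.card (f.map (Int.castRingHom ℂ)).roots = d := by
    have hsp := (IsAlgClosed.splits (f.map (Int.castRingHom ℂ))).natDegree_eq_card_roots
    rw [natDegree_map_eq_of_injective hinj] at hsp
    exact hsp.symm
  have hprod : ((f.map (Int.castRingHom ℂ)).roots.map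
      (fun α : ℂ => ‖(G.map (Int.castRingHom ℂ)).eval α‖)).prod ≤
      K ^ d * ((f.map (Int.castRingHom ℂ)).roots.map (fun α : ℂ => max 1 ‖α‖)).prod ^ N := by
    calc ((f.map (Int.castRingHom ℂ)).roots.map (fun α : ℂ => ‖(G.map (Int.castRingHom ℂ)).eval α‖)).prod
        ≤ ((f.map (Int.castRingHom ℂ)).roots.map (fun α : ℂ => K * max 1 ‖α‖ ^ N)).prod :=
          Multiset.prod_map_le_prod_map₀ _ _ (fun α _ => norm_nonneg _) (fun α _ => hroot α)
      _ = K ^ d * ((f.map (Int.castRingHom ℂ)).roots.map (fun α : ℂ => max 1 ‖α‖)).prod ^ N := by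
          rw [Multiset.prod_map_mul, Multiset.prod_map_pow, Multiset.map_const', Multiset.prod_replicate,
            hcard]
  have hM : intMahlerMeasure f = ‖(f.map (Int.castRingHom ℂ)).leadingCoeff‖ *
      ((f.map (Int.castRingHom ℂ)).roots.map (fun α : ℂ => max 1 ‖α‖)).prod :=
    mahlerMeasure_eq_leadingCoeff_mul_prod_roots _
  rw [hM, mul_pow]
  calc (|m| : ℝ) ^ d ≤ ‖(f.map (Int.castRingHom ℂ)).leadingCoeff‖ ^ N *
        ((f.map (Int.castRingHom ℂ)).roots.map (fun α : ℂ => ‖(G.map (Int.castRingHom ℂ)).eval α‖)).prod :=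
          hlowR
    _ ≤ ‖(f.map (Int.castRingHom ℂ)).leadingCoeff‖ ^ N *
        (K ^ d * ((f.map (Int.castRingHom ℂ)).roots.map (fun α : ℂ => max 1 ‖α‖)).prod ^ N) :=
          mul_le_mul_of_nonneg_left hprod (by positivity)
    _ = K ^ d * (‖(f.map (Int.castRingHom ℂ)).leadingCoeff‖ ^ N *
        ((f.map (Int.castRingHom ℂ)).roots.map (fun α : ℂ => max 1 ‖α‖)).prod ^ N) := by ring

/-- Per-root bound for a binomial auxiliary: `|α^N + c| ≤ 2 max(1,|α|)^N` when `|c| ≤ 1`. -/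
theorem norm_pow_add_le_two_mul (α c : ℂ) (hc : ‖c‖ ≤ 1) (N : ℕ) :
    ‖α ^ N + c‖ ≤ 2 * max 1 ‖α‖ ^ N := by
  have hm1 : 1 ≤ max 1 ‖α‖ := le_max_left _ _
  calc ‖α ^ N + c‖ ≤ ‖α ^ N‖ + ‖c‖ := norm_add_le _ _
    _ ≤ ‖α‖ ^ N + 1 := by rw [norm_pow]; exact add_le_add le_rfl hc
    _ ≤ max 1 ‖α‖ ^ N + max 1 ‖α‖ ^ N :=
        add_le_add (pow_le_pow_left₀ (norm_nonneg _) (le_max_right _ _) _) (one_le_pow₀ hm1)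
    _ = 2 * max 1 ‖α‖ ^ N := by ring

/-- `s = ±1` as a complex number has norm `≤ 1` (indeed `= 1`). -/
theorem norm_intCast_le_one_of_sign {s : ℤ} (hs : s = 1 ∨ s = -1) : ‖(s : ℂ)‖ ≤ 1 := by
  rcases hs with h | h <;> simp [h]

/-! ### Reciprocal / antireciprocal quadrinomials `x^{p+q} + b x^p + s b x^q + s` -/

section Quadrinomial

variable {p q : ℕ} {b s : ℤ}

/-- The quadrinomial is monic of degree `p + q` (for `0 < p < q`): it is `X^{p+q} +` (terms of degree `≤ q`). -/
theorem quadrinomial_monic_natDegree (hp : 0 < p) (hpq : p < q) (b s : ℤ) :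
    (X ^ (p + q) + C b * X ^ p + C (s * b) * X ^ q + C s : ℤ[X]).Monic ∧
      (X ^ (p + q) + C b * X ^ p + C (s * b) * X ^ q + C s : ℤ[X]).natDegree = p + q := by
  have hR : (C b * X ^ p + C (s * b) * X ^ q + C s : ℤ[X]).degree < (p + q : ℕ) := by
    refine lt_of_le_of_lt (degree_add_le _ _) (max_lt (lt_of_le_of_lt (degree_add_le _ _) (max_lt ?_ ?_)) ?_)
    · exact lt_of_le_of_lt (degree_C_mul_X_pow_le _ _) (by exact_mod_cast (show p < p + q by omega))
    · exact lt_of_le_of_lt (degree_C_mul_X_pow_le _ _) (by exact_mod_cast (show q < p + q by omega))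
    · exact lt_of_le_of_lt degree_C_le (by exact_mod_cast (show 0 < p + q by omega))
  have he : (X ^ (p + q) + C b * X ^ p + C (s * b) * X ^ q + C s : ℤ[X]) =
      X ^ (p + q) + (C b * X ^ p + C (s * b) * X ^ q + C s) := by ring
  have hXd : (X ^ (p + q) : ℤ[X]).degree = (p + q : ℕ) := degree_X_pow _
  rw [he]
  refine ⟨(monic_X_pow _).add_of_left (by rwa [hXd]), ?_⟩
  rw [natDegree_add_eq_left_of_degree_lt (by rwa [hXd]), natDegree_X_pow]

/-- **`|b| ≤ 2 M(P)`** for a cyclotomic-free quadrinomial `P = x^{p+q} + b x^p + s b x^q + s`, `s = ±1`,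
`0 < p < q`: the congruence `P ≡ x^{p+q} + s (mod b)` and the auxiliary `G = x^{p+q} + s`
(`|G(α)| ≤ 2 max(1,|α|)^{p+q}`). -/
theorem abs_le_two_mul_measure_quadrinomial (hp : 0 < p) (hpq : p < q) (hs : s = 1 ∨ s = -1)
    (hcf : ∀ k : ℕ, 0 < k → ¬ cyclotomic k ℤ ∣ (X ^ (p + q) + C b * X ^ p + C (s * b) * X ^ q + C s : ℤ[X])) :
    (|b| : ℝ) ≤ 2 * intMahlerMeasure (X ^ (p + q) + C b * X ^ p + C (s * b) * X ^ q + C s : ℤ[X]) := by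
  obtain ⟨hmon, hdeg⟩ := quadrinomial_monic_natDegree hp hpq b s
  set P : ℤ[X] := X ^ (p + q) + C b * X ^ p + C (s * b) * X ^ q + C s with hPdef
  have hP0 : P ≠ 0 := hmon.ne_zero
  set n := p + q with hn
  have hnpos : 0 < n := by omega
  -- `G = X^n + s = C b * (-(X^p + C s * X^q)) + P * 1`
  have hG : (X ^ n + C s : ℤ[X]) = C b * (-(X ^ p + C s * X ^ q)) + P * 1 := by
    rw [hPdef, map_mul]; ring
  have hGdeg : (X ^ n + C s : ℤ[X]).natDegree ≤ n := by
    rw [natDegree_X_pow_add_C]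
  have hne : P.resultant (X ^ n + C s) P.natDegree n ≠ 0 := by
    refine resultant_ne_zero_of_cyclotomicFree (L := 2 * n) hP0 hcf hGdeg (by omega) ?_
    intro z hz
    simp only [Polynomial.map_add, Polynomial.map_pow, map_X, eq_intCast, Polynomial.map_intCast,
      eval_add, eval_pow, eval_X, eval_intCast] at hz
    have hz' : z ^ n = -(s : ℂ) := eq_neg_of_add_eq_zero_left hz
    rw [pow_mul', hz', neg_sq]
    rcases hs with h | h <;> simp [h]
  have hroot : ∀ α : ℂ, ‖((X ^ n + C s : ℤ[X]).map (Int.castRingHom ℂ)).eval α‖ ≤ 2 * max 1 ‖α‖ ^ n := by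
    intro α
    simp only [Polynomial.map_add, Polynomial.map_pow, map_X, eq_intCast, Polynomial.map_intCast,
      eval_add, eval_pow, eval_X, eval_intCast]
    exact norm_pow_add_le_two_mul α (s : ℂ) (norm_intCast_le_one_of_sign hs) n
  have h := abs_pow_le_pow_mul_measure_pow_of_resultant (K := 2) hG
    (by rw [natDegree_one, hdeg]; omega) hGdeg hne hroot
  rw [hdeg, ← mul_pow] at h
  have hM0 : 0 ≤ 2 * intMahlerMeasure P := by
    have := one_le_intMahlerMeasure hP0; linarith
  exact le_of_pow_le_pow_left₀ (by omega) hM0 h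

/-- **`|b| ≤ M(P)²`** for a cyclotomic-free quadrinomial `P = x^{p+q} + b x^p + s b x^q + s` with `b` EVEN
(`s = ±1`, `0 < p < q`): writing `b = 2c` and `T = x^p + s x^q`, at every root `α` of `P` one has
`αⁿ + s = -2cT(α)` and `αⁿ - s = -2(cT(α) + s)`, i.e. `x^{2n} - 1 = 4c · T(cT + s) + P · H`; the
auxiliary `G = x^{2n} - 1` has `|G(α)| ≤ 2 max(1,|α|)^{2n}`, whence `(4|c|)ⁿ ≤ 2ⁿ M^{2n}`. -/
theorem abs_le_measure_sq_quadrinomial (hp : 0 < p) (hpq : p < q) (hs : s = 1 ∨ s = -1) (hb : Even b)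
    (hcf : ∀ k : ℕ, 0 < k → ¬ cyclotomic k ℤ ∣ (X ^ (p + q) + C b * X ^ p + C (s * b) * X ^ q + C s : ℤ[X])) :
    (|b| : ℝ) ≤ intMahlerMeasure (X ^ (p + q) + C b * X ^ p + C (s * b) * X ^ q + C s : ℤ[X]) ^ 2 := by
  obtain ⟨hmon, hdeg⟩ := quadrinomial_monic_natDegree hp hpq b s
  set P : ℤ[X] := X ^ (p + q) + C b * X ^ p + C (s * b) * X ^ q + C s with hPdef
  have hP0 : P ≠ 0 := hmon.ne_zero
  set n := p + q with hn
  have hnpos : 0 < n := by omega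
  obtain ⟨c, hc⟩ := hb
  have hss : s * s = 1 := by rcases hs with h | h <;> simp [h]
  set T : ℤ[X] := X ^ p + C s * X ^ q with hT
  have hCs : (C s : ℤ[X]) * C s = 1 := by rw [← map_mul, hss, map_one]
  -- the identity `X^{2n} - 1 = C (4c) * (T * (C c * T + C s)) + P * (P - C (4c) * T - C (2 s))`
  have hG : (X ^ (2 * n) - 1 : ℤ[X]) =
      C (4 * c) * (T * (C c * T + C s)) + P * (P - C (4 * c) * T - C (2 * s)) := by
    rw [hPdef, hT, hc]
    simp only [map_add, map_mul, map_ofNat]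
    linear_combination hCs
  have hGdeg : (X ^ (2 * n) - 1 : ℤ[X]).natDegree ≤ 2 * n := by
    rw [← C_1, natDegree_X_pow_sub_C]
  have hne : P.resultant (X ^ (2 * n) - 1) P.natDegree (2 * n) ≠ 0 :=
    resultant_X_pow_sub_one_ne_zero hP0 hcf (by omega)
  have hTdeg : T.natDegree ≤ q := by
    rw [hT]
    refine (natDegree_add_le _ _).trans (max_le ?_ ?_)
    · rw [natDegree_X_pow]; omega
    · exact (natDegree_C_mul_le _ _).trans (by rw [natDegree_X_pow])
  have hHdeg : (P - C (4 * c) * T - C (2 * s)).natDegree + P.natDegree ≤ 2 * n := by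
    have h1 : (P - C (4 * c) * T - C (2 * s)).natDegree ≤ n := by
      refine (natDegree_sub_le _ _).trans (max_le ((natDegree_sub_le _ _).trans (max_le ?_ ?_)) ?_)
      · rw [hdeg]
      · exact (natDegree_C_mul_le _ _).trans (hTdeg.trans (by omega))
      · rw [natDegree_C]; omega
    rw [hdeg]; omega
  have hroot : ∀ α : ℂ, ‖((X ^ (2 * n) - 1 : ℤ[X]).map (Int.castRingHom ℂ)).eval α‖ ≤
      2 * max 1 ‖α‖ ^ (2 * n) := by
    intro α
    simp only [Polynomial.map_sub, Polynomial.map_pow, map_X, Polynomial.map_one, eval_sub, eval_pow,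
      eval_X, eval_one]
    have := norm_pow_add_le_two_mul α (-1) (by simp) (2 * n)
    rwa [← sub_eq_add_neg] at this
  have h := abs_pow_le_pow_mul_measure_pow_of_resultant (K := 2) hG hHdeg hGdeg hne hroot
  rw [hdeg, pow_mul (intMahlerMeasure P) 2 n, ← mul_pow] at h
  have hM0 : 0 ≤ 2 * intMahlerMeasure P ^ 2 := by positivity
  have h2 := le_of_pow_le_pow_left₀ (by omega : n ≠ 0) hM0 h
  -- `|4c| ≤ 2 M²` gives `|b| = 2|c| ≤ M²`
  have h4 : (|((4 : ℤ) * c : ℤ)| : ℝ) = 4 * |(c : ℝ)| := by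
    push_cast; rw [abs_mul]; norm_num
  have h5 : (|b| : ℝ) = 2 * |(c : ℝ)| := by
    rw [hc]; push_cast; rw [← two_mul, abs_mul, abs_two]
  rw [h4] at h2
  rw [h5]
  linarith

/-- For `|b| ≤ 1` the quadrinomial `x^{p+q} + b x^p + s b x^q + s` (`s = ±1`, `0 < p < q`) is NOT
cyclotomic-free: for `b = 0` it is `x^{p+q} + s`, and for `b = ±1` it factors as `(x^p + e)(x^q + s e)`
with `e = s b`; in both cases it vanishes at some root of unity. -/
theorem not_cyclotomicFree_quadrinomial_of_abs_le_one (hp : 0 < p) (hpq : p < q) (hs : s = 1 ∨ s = -1)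
    (hb : |b| ≤ 1) :
    ¬ ∀ k : ℕ, 0 < k → ¬ cyclotomic k ℤ ∣ (X ^ (p + q) + C b * X ^ p + C (s * b) * X ^ q + C s : ℤ[X]) := by
  intro hcf
  have hss : s * s = 1 := by rcases hs with h | h <;> simp [h]
  have hs2 : (s : ℂ) * s = 1 := by exact_mod_cast hss
  by_cases hb0 : b = 0
  · -- `P = X^{p+q} + s`: take `α` with `α^{p+q} = -s`; then `α^{2(p+q)} = 1`
    obtain ⟨α, hα⟩ := IsAlgClosed.exists_pow_nat_eq (-(s : ℂ)) (show 0 < p + q by omega)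
    refine pow_ne_one_of_cyclotomicFree hcf (α := α) ?_ (show 0 < 2 * (p + q) by omega) ?_
    · rw [hb0]
      simp only [mul_zero, map_zero, zero_mul, add_zero, map_add, map_pow, aeval_X, eq_intCast,
        map_intCast, hα]
      ring
    · rw [pow_mul', hα, neg_sq]
      linear_combination hs2
  · -- `b = ±1`: with `e = s b`, any `α` with `α^p = -e` is a root, and `α^{2p} = 1`
    have hb1 : b = 1 ∨ b = -1 := by obtain ⟨h1, h2⟩ := abs_le.mp hb; omega
    have hbb : b * b = 1 := by rcases hb1 with h | h <;> simp [h]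
    have hb2 : (b : ℂ) * b = 1 := by exact_mod_cast hbb
    obtain ⟨α, hα⟩ := IsAlgClosed.exists_pow_nat_eq (-((s : ℂ) * b)) hp
    refine pow_ne_one_of_cyclotomicFree hcf (α := α) ?_ (show 0 < 2 * p by omega) ?_
    · simp only [map_add, map_mul, map_pow, aeval_X, eq_intCast, map_intCast, pow_add, hα]
      linear_combination (-(s : ℂ)) * hb2
    · rw [pow_mul', hα, neg_sq]
      linear_combination ((b : ℂ) * b) * hs2 + hb2

/-- **`M(P) ≥ √2` for every cyclotomic-free (anti)reciprocal quadrinomial**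
`P = x^{p+q} + b x^p + s b x^q + s` (`s = ±1`, `0 < p < q`, `b ∈ ℤ`): `|b| ≤ 1` is impossible,
`b` even gives `M² ≥ |b| ≥ 2`, and `b` odd gives `M ≥ |b|/2 ≥ 3/2`. -/
theorem sqrt_two_le_measure_quadrinomial (hp : 0 < p) (hpq : p < q) (hs : s = 1 ∨ s = -1)
    (hcf : ∀ k : ℕ, 0 < k → ¬ cyclotomic k ℤ ∣ (X ^ (p + q) + C b * X ^ p + C (s * b) * X ^ q + C s : ℤ[X])) :
    Real.sqrt 2 ≤ intMahlerMeasure (X ^ (p + q) + C b * X ^ p + C (s * b) * X ^ q + C s : ℤ[X]) := by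
  have hM1 : 1 ≤ intMahlerMeasure (X ^ (p + q) + C b * X ^ p + C (s * b) * X ^ q + C s : ℤ[X]) :=
    one_le_intMahlerMeasure (quadrinomial_monic_natDegree hp hpq b s).1.ne_zero
  have heven := fun hb : Even b => abs_le_measure_sq_quadrinomial hp hpq hs hb hcf
  have hodd' := abs_le_two_mul_measure_quadrinomial hp hpq hs hcf
  set M := intMahlerMeasure (X ^ (p + q) + C b * X ^ p + C (s * b) * X ^ q + C s : ℤ[X]) with hM
  have hb2 : 2 ≤ |b| := by
    by_contra h
    have h' : |b| ≤ 1 := by have := Int.lt_iff_add_one_le.mp (not_le.mp h); linarith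
    exact not_cyclotomicFree_quadrinomial_of_abs_le_one hp hpq hs h' hcf
  rcases Int.even_or_odd b with hev | hodd
  · have h := heven hev
    have h2 : (2 : ℝ) ≤ M ^ 2 := le_trans (by exact_mod_cast hb2) h
    calc Real.sqrt 2 ≤ Real.sqrt (M ^ 2) := Real.sqrt_le_sqrt h2
      _ = M := Real.sqrt_sq (by linarith)
  · have hb3 : 3 ≤ |b| := by
      rcases hodd with ⟨k, hk⟩
      rcases abs_choice b with h | h <;> rw [h] at hb2 ⊢ <;> omega
    have h3 : (3 : ℝ) ≤ 2 * M := le_trans (by exact_mod_cast hb3) hodd'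
    have hs2 : Real.sqrt 2 < 3 / 2 := by
      rw [show (3 : ℝ) / 2 = Real.sqrt ((3 / 2) ^ 2) by rw [Real.sqrt_sq (by norm_num)]]
      exact Real.sqrt_lt_sqrt (by norm_num) (by norm_num)
    linarith

end Quadrinomial


end Summit.Ventures.DiscreteObjects.Mahler
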